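import Summits.RiemannHypothesis.RiemannHypothesis.Theorems.SuzukiThetaFlowDecay

/-!
# Every pair of θ-flow window norms bounds Weil's ground energy from above (column DBR; RH-FREE)

RH-FREE (line 1 label); nothing here bears on the truth of RH.  TARGET-v10 §E.1 dictionary line N.1 of
rh-dbr-theory g10 (HOME/rh-dbr-theory/round3/EpsUpper.lean, sha as posted 2026-08-26T23:33:56Z), filed VERBATIM
by a prover hand (rh-dbr-eng-5 g6; theory does not file): a corollary of the θ-flow decay law
`SuzukiThetaFlow.thetaFlowDecay` (rh-dbr-eng-2 g5, p471795) — for `t > 0`, `1 < θ₀ < θ₁`, `f ∈ L²(−t,t)` with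
`‖𝖪_{θ₁}[t]f‖ ≠ 0`, `ε(t) ≤ log(‖𝖪_{θ₀}[t]f‖² / ‖𝖪_{θ₁}[t]f‖²) / (2(θ₁ − θ₀))`: the measured θ-decay of ONE window
output norm is an UPPER bound for Weil's ground energy `ε(t) = weilGroundEnergy t` of the window (the EXP-R2a
observable).  WHAT THIS IS NOT: no lower bound / sign of `ε(t)`, no statement about zeros; bears_on LADDER-RH
B-P(P2-flow) (dictionary for the registered D-0117 experiment), not progress toward RH.
-/

set_option linter.dupNamespace false

namespace Summit.RiemannHypothesis.RiemannHypothesis.Theorems.SuzukiThetaFlow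

open MeasureTheory Set Literature.NumberTheory.LFunctions

/-- **ε(t) ≤ log(N_{θ₀}/N_{θ₁}) / (2(θ₁−θ₀))**: the measured θ-decay of ONE window output norm is a certified upper bound for the
Weil ground energy of the window (EXP-R2a observable). -/
theorem weilGroundEnergy_le_log_div_of_winNormSq {t θ₀ θ₁ : ℝ} {f : ℝ → ℝ} (ht : 0 < t) (hθ₀ : 1 < θ₀) (hθ₀₁ : θ₀ < θ₁)
    (hf : MemLp f 2 (winMeasure t)) (hpos : 0 < winNormSq (limKernel θ₁) t f) :
    weilGroundEnergy t ≤
      Real.log (winNormSq (limKernel θ₀) t f / winNormSq (limKernel θ₁) t f) / (2 * (θ₁ - θ₀)) := by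
  set ε := weilGroundEnergy t with hε
  set N₀ := winNormSq (limKernel θ₀) t f with hN₀
  set N₁ := winNormSq (limKernel θ₁) t f with hN₁
  have h : N₁ ≤ Real.exp (-2 * ε * (θ₁ - θ₀)) * N₀ := thetaFlowDecay t ht θ₀ θ₁ hθ₀ hθ₀₁.le f hf
  have hexp : 0 < Real.exp (-2 * ε * (θ₁ - θ₀)) := Real.exp_pos _
  have hN0 : 0 < N₀ := by
    by_contra hle
    push Not at hle
    have : Real.exp (-2 * ε * (θ₁ - θ₀)) * N₀ ≤ 0 := mul_nonpos_of_nonneg_of_nonpos hexp.le hle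
    linarith
  have hratio : N₁ / N₀ ≤ Real.exp (-2 * ε * (θ₁ - θ₀)) := by
    rw [div_le_iff₀ hN0]
    exact h
  have hlog : Real.log (N₁ / N₀) ≤ -2 * ε * (θ₁ - θ₀) := by
    have := Real.log_le_log (div_pos hpos hN0) hratio
    rwa [Real.log_exp] at this
  have hlog' : Real.log (N₀ / N₁) = -Real.log (N₁ / N₀) := by
    rw [← Real.log_inv, inv_div]
  have hΔ : 0 < 2 * (θ₁ - θ₀) := by linarith
  rw [le_div_iff₀ hΔ, hlog']
  linarith

end Summit.RiemannHypothesis.RiemannHypothesis.Theorems.SuzukiThetaFlow
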